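import Summits.CriticalPhenomena.PercolationContinuityZ3.Theorems.Transplant.SkelNegBParamsFaceFloorsPinSYA
import Summits.CriticalPhenomena.PercolationContinuityZ3.Theorems.Transplant.SkelNegBParamsFaceFloorsLAdYA
import Summits.CriticalPhenomena.PercolationContinuityZ3.Theorems.Transplant.SkelNegBParamsFaceOriginsYLA
import Summits.CriticalPhenomena.PercolationContinuityZ3.Theorems.Transplant.SkelNegBParamsFaceOriginsXA
import Summits.CriticalPhenomena.PercolationContinuityZ3.Theorems.Transplant.SkelNegBParamsFaceOriginsYA
import Summits.CriticalPhenomena.PercolationContinuityZ3.Theorems.Transplant.SkelNegBParamsFramesF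
import Summits.CriticalPhenomena.PercolationContinuityZ3.Theorems.Transplant.SkelNegBParamsFaceFloorsClrYF
import Summits.CriticalPhenomena.PercolationContinuityZ3.Theorems.Transplant.SkelNegBParamsFaceFloorsClrYA
import Summits.CriticalPhenomena.PercolationContinuityZ3.Theorems.Transplant.SkelNegBParamsFaceFloorsFAYA
import Summits.CriticalPhenomena.PercolationContinuityZ3.Theorems.Transplant.SkelNegBParamsFaceFloorsFBYA
import Summits.CriticalPhenomena.PercolationContinuityZ3.Theorems.Transplant.SkelNegBParamsFaceFloorsFTYA
import Summits.CriticalPhenomena.PercolationContinuityZ3.Theorems.Transplant.SkelNegBParamsFaceFloorsLYA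
import Summits.CriticalPhenomena.PercolationContinuityZ3.Theorems.Transplant.SkelNegBParamsFaceFloorsQYA
import Summits.CriticalPhenomena.PercolationContinuityZ3.Theorems.Transplant.SkelNegBParamsFaceFloorsZPiYA
import Summits.CriticalPhenomena.PercolationContinuityZ3.Theorems.Transplant.SkelNegBParamsFaceFloorsZPiYA2
import Summits.CriticalPhenomena.PercolationContinuityZ3.Theorems.Transplant.SkelNegBParamsFaceOriginsYLA
import Summits.CriticalPhenomena.PercolationContinuityZ3.Theorems.Transplant.SkelNegBParamsFaceFloorsPinYA
import Summits.CriticalPhenomena.PercolationContinuityZ3.Theorems.Transplant.SkelNegBParamsFaceCountsYA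
import Summits.CriticalPhenomena.PercolationContinuityZ3.Theorems.Transplant.SkelNegBParamsFaceCountsRangeYA
import Summits.CriticalPhenomena.PercolationContinuityZ3.Theorems.Transplant.SkelNegBParamsFaceCountsShiftYA
import Summits.CriticalPhenomena.PercolationContinuityZ3.Theorems.Transplant.SkelPhiFaceNumsYP2
import HarnessLib

/-!
# N1 (the `{±1}` node), (F) column, M3 — **THE y′-FACE `Skelφ.FloorsY2` ASSEMBLED AT THE (ζ′) TUPLE, bridge case SAME** (`o_b = o_L`, frame `KS.BFs … σh`,
# origin `yL := KS.yLFs c mk g f (sgOf du) σh`, start half-height `qB′ := KS.qBF c mk g f`, `qB₃′ := KS.qB3YA g f (RA′ mk)`, counts `NrY/σTY/N3Y` (hp-8 CountsYA)):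
# all 29 fields, every group by `exact` on its owner's landed lemma — G-Z′/G-π′/G-clr′ p1 (ZPiYA/PinYA/ZPiYA2/ClrYF), G-L′/G-fit′ hp-8 (LYA via stmt's adapters
# `floorsFL_YA` LAdYA, QYA `hW_YA₂`), G-A′/G-T′ stmt (FAYA/FBYA/FTYA via the pins `floorsFA_YA/floorsFB_YA/floorsFT_YA` PinSYA), G-O′ stmt-g16/g17 (FramesF
# `hxaF_s/hxbF_s`, OriginsYA/YQA/YLA readings `Λ_yLFs`, budgets `four_U_qBF_le/two_U_qBF_le`, size `hyl_yLF`), `hq₃` FaceRunA. Skeleton: p3-g12's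
# FloorsY2AssemblyS.dev (10:30Z). Remaining premises are glue-level (as in the x-face X2SA p3-g12): `hN hκ` from `hAt`, slot floors `hnA hℓA hS hS64 hs0 hs1 hkF0 hkF1`,
# the band `E := RlevA + reachA` with `hEu/hE2/hkE/hkE8/hkE24` (`kE := kFF₂ … (E−1) 1`; `hkE24` = FTYA `hkE24_RA₂`), the hop side `σh` with the (L-F1) convention
# `hhopLo/hhopHi`, the bridge-offset index `hc : NrY + 1 ≤ c` (at v3: `NegB.hc_cK κ …` from `NrY_range….2`), and the r-floor `hr`.
# (stmt-g17 2026-08-22; integrator row p3 — filed by stmt per the lead's ruling / with p3's consent, see lane INBOX.)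
builds on p205010 (kernel theorem, internal audit signed; external expert review pending) — nothing in this file uses p205010; NOTHING is claimed about the node
`SamePDropOfSkeletonNeg₁` (OPEN): this is the y′ half of the M3 input of the (F) wrapper, not the wrapper.
Lane `prim-bschramm-*`, seats `prim-bschramm-p3` (skeleton) / `prim-bschramm-stmt` (gen 17, assembly); helper file (`--supports stmt-CriticalPhenomena-4575 --as helper`).
[cite: KozmaNitzan2024, §4 Lemma 11–12 (pp. 21–25)] [cite: MartineauTassion2017, §4.1]
-/

noncomputable section

open scoped Classical

namespace Summit.CriticalPhenomena.PercolationContinuityZ3.Theorems.Transplant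

namespace PlanarSkeletonNeg

namespace NegB

open Literature.Probability.Percolation Literature.Probability.LatticeModels SimpleGraph KNCells KNLevels
open Literature.Probability.Percolation.KozmaNitzan.Cells (oth sgOf sgOf_sign stepVec_apply_fst)
open SkelConc (Consts)
open Skelφ (shearUnit shearUnit_pos)
open Skelφ.StepI (DataN)
open ChainPlanar (BridgePrm)
open TwoAxis.Para (modulus)
open Neg

namespace KS

variable (κ : Consts) {V : Type} [DecidableEq V] [Countable V] {G : SimpleGraph V} [G.LocallyFinite] (Φ : PlanarSkeletonNeg G) (t : V)
  (p : unitInterval) (D : DataN V) (c mk : ℕ) (gx fx : Neg.FSlot)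

set_option maxHeartbeats 4000000 in
/-- **M3, y′-face: `Skelφ.FloorsY2` at the (ζ′) tuple, bridge case same (`KS.BFs`)** — all 29 fields at the landing origin `yLFs` of the case (see the module
docstring for the groups and the remaining glue-level hypotheses). [cite: KozmaNitzan2024, §4 Lemma 11–12 (pp. 21–25)] -/
theorem floorsY2_YFs
    (hN : EqNumL κ Φ t p D (gT mk gx κ Φ t p D) (fT mk fx κ Φ t p D)) (hκ : (hL κ Φ t p D (gT mk gx κ Φ t p D) (fT mk fx κ Φ t p D)).natAbs ≤ 10 * nL κ Φ t p D (gT mk gx κ Φ t p D) (fT mk fx κ Φ t p D))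
    (hnA : 2000 * Neg.Kq κ * (RA' κ Φ t p D mk + 2) ≤ nL κ Φ t p D (gT mk gx κ Φ t p D) (fT mk fx κ Φ t p D))
    (hℓA : 22000 * Neg.Kq κ * (RA' κ Φ t p D mk + 2) ≤ ℓL κ Φ t p D (gT mk gx κ Φ t p D) (fT mk fx κ Φ t p D))
    (hS : 16 * SF κ Φ t p D c mk ≤ ML κ Φ t p D (gT mk gx κ Φ t p D)) (hS64 : 64 * SF κ Φ t p D c mk ≤ ML κ Φ t p D (gT mk gx κ Φ t p D))
    (hs0 : 6 * (RA' κ Φ t p D mk : ℤ) + 11 ≤ u₀A κ Φ t p D (gT mk gx κ Φ t p D) (fT mk fx κ Φ t p D)) (hs1 : 6 * (RA' κ Φ t p D mk : ℤ) + 11 ≤ u₁A κ Φ t p D (gT mk gx κ Φ t p D) (fT mk fx κ Φ t p D))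
    (hkF0 : kF₀A κ Φ t p D c mk (gT mk gx κ Φ t p D) (fT mk fx κ Φ t p D) ≤ 8 * u₀A κ Φ t p D (gT mk gx κ Φ t p D) (fT mk fx κ Φ t p D) + 1)
    (hkF1 : kF₁A κ Φ t p D c mk (gT mk gx κ Φ t p D) (fT mk fx κ Φ t p D) ≤ 8 * u₁A κ Φ t p D (gT mk gx κ Φ t p D) (fT mk fx κ Φ t p D) + 1)
    (x : Site 2) (du : MDir) (hd : du.1 = 1) (j : ℕ) (hj : j < (fcellsA κ Φ t p D (gT mk gx κ Φ t p D) (fT mk fx κ Φ t p D)).K) (z : Site 2) {E : ℕ} {kE : ℤ}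
    (hlev1 : (fcellsA κ Φ t p D (gT mk gx κ Φ t p D) (fT mk fx κ Φ t p D)).faceL 1 j - E ≤ (fcellsA κ Φ t p D (gT mk gx κ Φ t p D) (fT mk fx κ Φ t p D)).lev du x z)
    (hlev2 : (fcellsA κ Φ t p D (gT mk gx κ Φ t p D) (fT mk fx κ Φ t p D)).lev du x z ≤ (fcellsA κ Φ t p D (gT mk gx κ Φ t p D) (fT mk fx κ Φ t p D)).faceL 1 j + E)
    (hz : |z 0 - (fcellsA κ Φ t p D (gT mk gx κ Φ t p D) (fT mk fx κ Φ t p D)).cen x 0| ≤ kE)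
    (hEu : (E : ℤ) ≤ u₁A κ Φ t p D (gT mk gx κ Φ t p D) (fT mk fx κ Φ t p D)) (hE2 : (E : ℤ) ≤ 2 * (RA' κ Φ t p D mk : ℤ))
    (hkE : kE ≤ 5 * ((fcellsA κ Φ t p D (gT mk gx κ Φ t p D) (fT mk fx κ Φ t p D)).r 0 : ℤ))
    (hkE8 : kE + 8 * u₀A κ Φ t p D (gT mk gx κ Φ t p D) (fT mk fx κ Φ t p D) + 8 ≤ 5 * ((fcellsA κ Φ t p D (gT mk gx κ Φ t p D) (fT mk fx κ Φ t p D)).r 0 : ℤ))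
    (hkE24h : 2 * kE + 24 * u₀A κ Φ t p D (gT mk gx κ Φ t p D) (fT mk fx κ Φ t p D) + 24 ≤ 5 * ((fcellsA κ Φ t p D (gT mk gx κ Φ t p D) (fT mk fx κ Φ t p D)).r 0 : ℤ))
    (σh : ℤ) (hσh : σh = 1 ∨ σh = -1) (hhopLo : sgOf du * σh = 1 → 0 ≤ vL κ Φ t p D (gT mk gx κ Φ t p D) (fT mk fx κ Φ t p D)) (hhopHi : sgOf du * σh = -1 → vL κ Φ t p D (gT mk gx κ Φ t p D) (fT mk fx κ Φ t p D) ≤ 0)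
    (hc : NrY κ Φ t p D (gT mk gx κ Φ t p D) (fT mk fx κ Φ t p D) (yLFs κ Φ t p D c mk (gT mk gx κ Φ t p D) (fT mk fx κ Φ t p D) (sgOf du) σh) x du z + 1 ≤ c)
    (r : ℕ) (hr : ∀ X : ℕ, X + 1 ≤ exA κ Φ t p D (gT mk gx κ Φ t p D) (fT mk fx κ Φ t p D) → X ≤ r) :
    Skelφ.FloorsY2 (prFA κ Φ t p D (gT mk gx κ Φ t p D) (fT mk fx κ Φ t p D)) (nL κ Φ t p D (gT mk gx κ Φ t p D) (fT mk fx κ Φ t p D)) (u₀A κ Φ t p D (gT mk gx κ Φ t p D) (fT mk fx κ Φ t p D)) (u₁A κ Φ t p D (gT mk gx κ Φ t p D) (fT mk fx κ Φ t p D))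
      (modulus (nL κ Φ t p D (gT mk gx κ Φ t p D) (fT mk fx κ Φ t p D)) (hL κ Φ t p D (gT mk gx κ Φ t p D) (fT mk fx κ Φ t p D)) (vL κ Φ t p D (gT mk gx κ Φ t p D) (fT mk fx κ Φ t p D)) (vβL κ Φ t p D (gT mk gx κ Φ t p D) (fT mk fx κ Φ t p D))) (nL κ Φ t p D (gT mk gx κ Φ t p D) (fT mk fx κ Φ t p D) : ℤ) (ℓL κ Φ t p D (gT mk gx κ Φ t p D) (fT mk fx κ Φ t p D))
      (fcellsA κ Φ t p D (gT mk gx κ Φ t p D) (fT mk fx κ Φ t p D)) (b0TA κ Φ t p D (gT mk gx κ Φ t p D) (fT mk fx κ Φ t p D)) x du j 3 r (Mu D) z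
      (fun i => if i = 0 then kF₀A κ Φ t p D c mk (gT mk gx κ Φ t p D) (fT mk fx κ Φ t p D) else kF₁A κ Φ t p D c mk (gT mk gx κ Φ t p D) (fT mk fx κ Φ t p D))
      σh (BFs κ Φ t p D c mk (gT mk gx κ Φ t p D) (fT mk fx κ Φ t p D) σh) (RA' κ Φ t p D mk) (qBF κ Φ t p D c mk (gT mk gx κ Φ t p D) (fT mk fx κ Φ t p D)) (RA' κ Φ t p D mk) (qB3YA κ Φ t p D (gT mk gx κ Φ t p D) (fT mk fx κ Φ t p D) (RA' κ Φ t p D mk))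
      (yLFs κ Φ t p D c mk (gT mk gx κ Φ t p D) (fT mk fx κ Φ t p D) (sgOf du) σh) (NrY κ Φ t p D (gT mk gx κ Φ t p D) (fT mk fx κ Φ t p D) (yLFs κ Φ t p D c mk (gT mk gx κ Φ t p D) (fT mk fx κ Φ t p D) (sgOf du) σh) x du z) (N3Y κ Φ t p D (gT mk gx κ Φ t p D) (fT mk fx κ Φ t p D) (yLFs κ Φ t p D c mk (gT mk gx κ Φ t p D) (fT mk fx κ Φ t p D) (sgOf du) σh) x z) (σTY κ Φ t p D (gT mk gx κ Φ t p D) (fT mk fx κ Φ t p D) (yLFs κ Φ t p D c mk (gT mk gx κ Φ t p D) (fT mk fx κ Φ t p D) (sgOf du) σh) x z) := by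
  have hσ : sgOf du = 1 ∨ sgOf du = -1 := sgOf_sign du
  have hqB2 := two_U_qBF_le κ Φ t p D c mk (gT mk gx κ Φ t p D) (fT mk fx κ Φ t p D) hN hκ
  have hyl := (hyl_yLF κ Φ t p D c mk gx (fT mk fx κ Φ t p D) hN hκ hS hσ hσh).1
  obtain ⟨hΛ₀, hΛ₁⟩ := Λ_yLFs κ Φ t p D c mk gx (fT mk fx κ Φ t p D) hN hκ hS hσ hσh
  have hσT : (σTY κ Φ t p D (gT mk gx κ Φ t p D) (fT mk fx κ Φ t p D) (yLFs κ Φ t p D c mk (gT mk gx κ Φ t p D) (fT mk fx κ Φ t p D) (sgOf du) σh) x z) = 1 ∨ (σTY κ Φ t p D (gT mk gx κ Φ t p D) (fT mk fx κ Φ t p D) (yLFs κ Φ t p D c mk (gT mk gx κ Φ t p D) (fT mk fx κ Φ t p D) (sgOf du) σh) x z) = -1 := (N3Y_spec κ Φ t p D (gT mk gx κ Φ t p D) (fT mk fx κ Φ t p D) (yLFs κ Φ t p D c mk (gT mk gx κ Φ t p D) (fT mk fx κ Φ t p D) (sgOf du) σh) x z).1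
  have he0 : |FcA κ Φ t p D (gT mk gx κ Φ t p D) (fT mk fx κ Φ t p D) (yLFs κ Φ t p D c mk (gT mk gx κ Φ t p D) (fT mk fx κ Φ t p D) (sgOf du) σh)| ≤ 5 * u₀A κ Φ t p D (gT mk gx κ Φ t p D) (fT mk fx κ Φ t p D) := abs_FcA_le_of_Λ₀ κ Φ t p D (gT mk gx κ Φ t p D) (fT mk fx κ Φ t p D) hN (yLFs κ Φ t p D c mk (gT mk gx κ Φ t p D) (fT mk fx κ Φ t p D) (sgOf du) σh) hΛ₀
  have he1 : |F1cA κ Φ t p D (gT mk gx κ Φ t p D) (fT mk fx κ Φ t p D) (yLFs κ Φ t p D c mk (gT mk gx κ Φ t p D) (fT mk fx κ Φ t p D) (sgOf du) σh)| ≤ 2 * u₁A κ Φ t p D (gT mk gx κ Φ t p D) (fT mk fx κ Φ t p D) := abs_F1cA_le_of_Λ₁ κ Φ t p D (gT mk gx κ Φ t p D) (fT mk fx κ Φ t p D) hN (yLFs κ Φ t p D c mk (gT mk gx κ Φ t p D) (fT mk fx κ Φ t p D) (sgOf du) σh) hΛ₁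
  have hu0 : 1 ≤ u₀A κ Φ t p D (gT mk gx κ Φ t p D) (fT mk fx κ Φ t p D) := (units_eqA κ Φ t p D (gT mk gx κ Φ t p D) (fT mk fx κ Φ t p D)).2.2.2.2.2.2.1
  have hu1 : 1 ≤ u₁A κ Φ t p D (gT mk gx κ Φ t p D) (fT mk fx κ Φ t p D) := (units_eqA κ Φ t p D (gT mk gx κ Φ t p D) (fT mk fx κ Φ t p D)).2.2.2.2.2.2.2
  have he0' : |FcA κ Φ t p D (gT mk gx κ Φ t p D) (fT mk fx κ Φ t p D) (yLFs κ Φ t p D c mk (gT mk gx κ Φ t p D) (fT mk fx κ Φ t p D) (sgOf du) σh)| ≤ 6 * u₀A κ Φ t p D (gT mk gx κ Φ t p D) (fT mk fx κ Φ t p D) := by linarith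
  have he1' : |F1cA κ Φ t p D (gT mk gx κ Φ t p D) (fT mk fx κ Φ t p D) (yLFs κ Φ t p D c mk (gT mk gx κ Φ t p D) (fT mk fx κ Φ t p D) (sgOf du) σh)| ≤ 6 * u₁A κ Φ t p D (gT mk gx κ Φ t p D) (fT mk fx κ Φ t p D) := by linarith
  obtain ⟨hX, hNr⟩ := NrY_range κ Φ t p D (gT mk gx κ Φ t p D) (fT mk fx κ Φ t p D) x du hd z hj hlev1 hlev2 (yLFs κ Φ t p D c mk (gT mk gx κ Φ t p D) (fT mk fx κ Φ t p D) (sgOf du) σh) he1 (by linarith)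
  have hN3 := N3Y_range κ Φ t p D (gT mk gx κ Φ t p D) (fT mk fx κ Φ t p D) (yLFs κ Φ t p D c mk (gT mk gx κ Φ t p D) (fT mk fx κ Φ t p D) (sgOf du) σh) x z hz hkE he0 (by linarith)
  have hΛ₁3 : |Λ₁of κ Φ t p D (gT mk gx κ Φ t p D) (fT mk fx κ Φ t p D) (yLFs κ Φ t p D c mk (gT mk gx κ Φ t p D) (fT mk fx κ Φ t p D) (sgOf du) σh)| ≤ 3 * modulus (nL κ Φ t p D (gT mk gx κ Φ t p D) (fT mk fx κ Φ t p D)) (hL κ Φ t p D (gT mk gx κ Φ t p D) (fT mk fx κ Φ t p D)) (vL κ Φ t p D (gT mk gx κ Φ t p D) (fT mk fx κ Φ t p D)) (vβL κ Φ t p D (gT mk gx κ Φ t p D) (fT mk fx κ Φ t p D)) :=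
    hΛ₁.trans (by linarith [abs_nonneg (Λ₁of κ Φ t p D (gT mk gx κ Φ t p D) (fT mk fx κ Φ t p D) (yLFs κ Φ t p D c mk (gT mk gx κ Φ t p D) (fT mk fx κ Φ t p D) (sgOf du) σh))])
  have hqB4 := four_U_qBF_le κ Φ t p D c mk (gT mk gx κ Φ t p D) (fT mk fx κ Φ t p D) hN hκ hS hℓA
  have hNr1000 : NrY κ Φ t p D (gT mk gx κ Φ t p D) (fT mk fx κ Φ t p D) (yLFs κ Φ t p D c mk (gT mk gx κ Φ t p D) (fT mk fx κ Φ t p D) (sgOf du) σh) x du z + 1 ≤ 1000 * Neg.Kq κ := by have := Neg.one_le_Kq κ; omega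
  have hkE24 : 2 * kE + 24 * u₀A κ Φ t p D (gT mk gx κ Φ t p D) (fT mk fx κ Φ t p D) + 24 ≤ 5 * ((fcellsA κ Φ t p D (gT mk gx κ Φ t p D) (fT mk fx κ Φ t p D)).r 0 : ℤ) := hkE24h
  refine ⟨?_, ?_, hσT, ?_, ?_, ?_, ?_, ?_, ?_, ?_, ?_, ?_, ?_, ?_, ?_, ?_, ?_, ?_, ?_, ?_, ?_, hσh, ?_, ?_, ?_, ?_, ?_, ?_, ?_⟩
  · exact hfR_YA_gen κ Φ t p D c mk (gT mk gx κ Φ t p D) (fT mk fx κ Φ t p D) x du hd j hj z hlev1 hlev2 hz hEu hkF0 hkF1 hs1 hkE8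
  · exact hZfar_YA_gen κ Φ t p D c mk (gT mk gx κ Φ t p D) (fT mk fx κ Φ t p D) x du hd j hj z hlev2 hEu hkF1
  · intro hσ1 k hk; rw [hd]; exact (floorsFA_YA κ Φ t p D (gT mk gx κ Φ t p D) (fT mk fx κ Φ t p D) mk hN hκ hℓA hs1 x du hd j hj z hlev1 hlev2 hE2 (yLFs κ Φ t p D c mk (gT mk gx κ Φ t p D) (fT mk fx κ Φ t p D) (sgOf du) σh) he1' hΛ₁3 hqB4).1 hσ1 k hk
  · intro hσ1 k hk; rw [hd]; exact (floorsFA_YA κ Φ t p D (gT mk gx κ Φ t p D) (fT mk fx κ Φ t p D) mk hN hκ hℓA hs1 x du hd j hj z hlev1 hlev2 hE2 (yLFs κ Φ t p D c mk (gT mk gx κ Φ t p D) (fT mk fx κ Φ t p D) (sgOf du) σh) he1' hΛ₁3 hqB4).2.1 hσ1 k hk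
  · intro hσ1 k hk; rw [hd]; exact (floorsFA_YA κ Φ t p D (gT mk gx κ Φ t p D) (fT mk fx κ Φ t p D) mk hN hκ hℓA hs1 x du hd j hj z hlev1 hlev2 hE2 (yLFs κ Φ t p D c mk (gT mk gx κ Φ t p D) (fT mk fx κ Φ t p D) (sgOf du) σh) he1' hΛ₁3 hqB4).2.2.1 hσ1 k hk
  · intro hσ1 k hk; rw [hd]; exact (floorsFA_YA κ Φ t p D (gT mk gx κ Φ t p D) (fT mk fx κ Φ t p D) mk hN hκ hℓA hs1 x du hd j hj z hlev1 hlev2 hE2 (yLFs κ Φ t p D c mk (gT mk gx κ Φ t p D) (fT mk fx κ Φ t p D) (sgOf du) σh) he1' hΛ₁3 hqB4).2.2.2 hσ1 k hk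
  · intro k hk; rw [hd]; exact (floorsFB_YA κ Φ t p D (gT mk gx κ Φ t p D) (fT mk fx κ Φ t p D) mk hN hκ hnA hℓA x z (yLFs κ Φ t p D c mk (gT mk gx κ Φ t p D) (fT mk fx κ Φ t p D) (sgOf du) σh) he0' hz hkE24 hqB4 hNr1000).1 k hk
  · intro k hk; rw [hd]; exact (floorsFB_YA κ Φ t p D (gT mk gx κ Φ t p D) (fT mk fx κ Φ t p D) mk hN hκ hnA hℓA x z (yLFs κ Φ t p D c mk (gT mk gx κ Φ t p D) (fT mk fx κ Φ t p D) (sgOf du) σh) he0' hz hkE24 hqB4 hNr1000).2 k hk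
  · intro hσ1 k hk; rw [hd]; exact (floorsFT_YA κ Φ t p D (gT mk gx κ Φ t p D) (fT mk fx κ Φ t p D) mk hN hκ hnA hℓA hs0 hs1 x du hd j hj z hlev1 hlev2 hE2 hz hkE hkE24 (yLFs κ Φ t p D c mk (gT mk gx κ Φ t p D) (fT mk fx κ Φ t p D) (sgOf du) σh) he0' he1').1 hσ1 k hk
  · intro hσ1 k hk; rw [hd]; exact (floorsFT_YA κ Φ t p D (gT mk gx κ Φ t p D) (fT mk fx κ Φ t p D) mk hN hκ hnA hℓA hs0 hs1 x du hd j hj z hlev1 hlev2 hE2 hz hkE hkE24 (yLFs κ Φ t p D c mk (gT mk gx κ Φ t p D) (fT mk fx κ Φ t p D) (sgOf du) σh) he0' he1').2.1 hσ1 k hk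
  · intro hσ1 k hk; rw [hd]; exact (floorsFT_YA κ Φ t p D (gT mk gx κ Φ t p D) (fT mk fx κ Φ t p D) mk hN hκ hnA hℓA hs0 hs1 x du hd j hj z hlev1 hlev2 hE2 hz hkE hkE24 (yLFs κ Φ t p D c mk (gT mk gx κ Φ t p D) (fT mk fx κ Φ t p D) (sgOf du) σh) he0' he1').2.2.1 hσ1 k hk
  · intro hσ1 k hk; rw [hd]; exact (floorsFT_YA κ Φ t p D (gT mk gx κ Φ t p D) (fT mk fx κ Φ t p D) mk hN hκ hnA hℓA hs0 hs1 x du hd j hj z hlev1 hlev2 hE2 hz hkE hkE24 (yLFs κ Φ t p D c mk (gT mk gx κ Φ t p D) (fT mk fx κ Φ t p D) (sgOf du) σh) he0' he1').2.2.2.1 hσ1 k hk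
  · intro k hk; rw [hd]; exact (floorsFT_YA κ Φ t p D (gT mk gx κ Φ t p D) (fT mk fx κ Φ t p D) mk hN hκ hnA hℓA hs0 hs1 x du hd j hj z hlev1 hlev2 hE2 hz hkE hkE24 (yLFs κ Φ t p D c mk (gT mk gx κ Φ t p D) (fT mk fx κ Φ t p D) (sgOf du) σh) he0' he1').2.2.2.2.1 k hk
  · intro k hk; rw [hd]; exact (floorsFT_YA κ Φ t p D (gT mk gx κ Φ t p D) (fT mk fx κ Φ t p D) mk hN hκ hnA hℓA hs0 hs1 x du hd j hj z hlev1 hlev2 hE2 hz hkE hkE24 (yLFs κ Φ t p D c mk (gT mk gx κ Φ t p D) (fT mk fx κ Φ t p D) (sgOf du) σh) he0' he1').2.2.2.2.2 k hk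
  · exact (floorsFL_YA κ Φ t p D (gT mk gx κ Φ t p D) (fT mk fx κ Φ t p D) mk hN hκ hnA hℓA hs0 hs1 x du hd j hj z hlev1 hlev2 hE2 hz hkE (yLFs κ Φ t p D c mk (gT mk gx κ Φ t p D) (fT mk fx κ Φ t p D) (sgOf du) σh) he0' he1').1
  · exact (floorsFL_YA κ Φ t p D (gT mk gx κ Φ t p D) (fT mk fx κ Φ t p D) mk hN hκ hnA hℓA hs0 hs1 x du hd j hj z hlev1 hlev2 hE2 hz hkE (yLFs κ Φ t p D c mk (gT mk gx κ Φ t p D) (fT mk fx κ Φ t p D) (sgOf du) σh) he0' he1').2.1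
  · exact (floorsFL_YA κ Φ t p D (gT mk gx κ Φ t p D) (fT mk fx κ Φ t p D) mk hN hκ hnA hℓA hs0 hs1 x du hd j hj z hlev1 hlev2 hE2 hz hkE (yLFs κ Φ t p D c mk (gT mk gx κ Φ t p D) (fT mk fx κ Φ t p D) (sgOf du) σh) he0' he1').2.2.1
  · exact (floorsFL_YA κ Φ t p D (gT mk gx κ Φ t p D) (fT mk fx κ Φ t p D) mk hN hκ hnA hℓA hs0 hs1 x du hd j hj z hlev1 hlev2 hE2 hz hkE (yLFs κ Φ t p D c mk (gT mk gx κ Φ t p D) (fT mk fx κ Φ t p D) (sgOf du) σh) he0' he1').2.2.2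
  · exact hq₃Y_RA κ Φ t p D (gT mk gx κ Φ t p D) (fT mk fx κ Φ t p D) (RA' κ Φ t p D mk) hNr1000
  · exact hW_YA₂ κ Φ t p D c mk (gT mk gx κ Φ t p D) (fT mk fx κ Φ t p D) hN hκ hℓA hS64 hNr hqB2
  · exact hxaF_s κ Φ t p D c mk gx fx hN hσ hσh
  · exact hxbF_s κ Φ t p D c mk gx fx hN hσ hσh
  · exact hclrLo_YFs κ Φ t p D c mk (gT mk gx κ Φ t p D) (fT mk fx κ Φ t p D) hN du hhopLo hc
  · exact hclrHi_YFs κ Φ t p D c mk (gT mk gx κ Φ t p D) (fT mk fx κ Φ t p D) hN du hhopHi hc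
  · exact hclr₃_YA κ Φ t p D mk (gT mk gx κ Φ t p D) (fT mk fx κ Φ t p D) hN hκ hℓA x du hd j hj z hlev1 hlev2 hz hEu hkE (yLFs κ Φ t p D c mk (gT mk gx κ Φ t p D) (fT mk fx κ Φ t p D) (sgOf du) σh) he0' he1' _
  · exact hπ2Y_YA₂ κ Φ t p D c mk (gT mk gx κ Φ t p D) (fT mk fx κ Φ t p D) hN hκ hnA hℓA hS x du hd j hj z hlev1 hlev2 hEu (yLFs κ Φ t p D c mk (gT mk gx κ Φ t p D) (fT mk fx κ Φ t p D) (sgOf du) σh) he1' hyl _ r hr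
  · exact hπ3Y_YA₂ κ Φ t p D c mk (gT mk gx κ Φ t p D) (fT mk fx κ Φ t p D) hN hκ hnA hℓA hS x du hd j hj z hlev1 hlev2 hz hEu hkE (yLFs κ Φ t p D c mk (gT mk gx κ Φ t p D) (fT mk fx κ Φ t p D) (sgOf du) σh) he0' he1' hyl r hr


/-- **The y′ counts' ranges at the origin `yLFs`** (the sibling the FloorsS/D/T packager reads for the capped witnesses, lead (g9) 11:24Z):
`NrY + 1 ≤ 600·Kq` and `N3Y + 1 ≤ 200·Kq + 10`. [folklore] -/
theorem rangesY_YFs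
    (hN : EqNumL κ Φ t p D (gT mk gx κ Φ t p D) (fT mk fx κ Φ t p D)) (hκ : (hL κ Φ t p D (gT mk gx κ Φ t p D) (fT mk fx κ Φ t p D)).natAbs ≤ 10 * nL κ Φ t p D (gT mk gx κ Φ t p D) (fT mk fx κ Φ t p D))
    (hS : 16 * SF κ Φ t p D c mk ≤ ML κ Φ t p D (gT mk gx κ Φ t p D))
    (x : Site 2) (du : MDir) (hd : du.1 = 1) (j : ℕ) (hj : j < (fcellsA κ Φ t p D (gT mk gx κ Φ t p D) (fT mk fx κ Φ t p D)).K) (z : Site 2) {E : ℕ} {kE : ℤ}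
    (hlev1 : (fcellsA κ Φ t p D (gT mk gx κ Φ t p D) (fT mk fx κ Φ t p D)).faceL 1 j - E ≤ (fcellsA κ Φ t p D (gT mk gx κ Φ t p D) (fT mk fx κ Φ t p D)).lev du x z)
    (hlev2 : (fcellsA κ Φ t p D (gT mk gx κ Φ t p D) (fT mk fx κ Φ t p D)).lev du x z ≤ (fcellsA κ Φ t p D (gT mk gx κ Φ t p D) (fT mk fx κ Φ t p D)).faceL 1 j + E)
    (hz : |z 0 - (fcellsA κ Φ t p D (gT mk gx κ Φ t p D) (fT mk fx κ Φ t p D)).cen x 0| ≤ kE) (hEu : (E : ℤ) ≤ u₁A κ Φ t p D (gT mk gx κ Φ t p D) (fT mk fx κ Φ t p D)) (hkE : kE ≤ 5 * ((fcellsA κ Φ t p D (gT mk gx κ Φ t p D) (fT mk fx κ Φ t p D)).r 0 : ℤ))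
    (σh : ℤ) (hσh : σh = 1 ∨ σh = -1) :
    NrY κ Φ t p D (gT mk gx κ Φ t p D) (fT mk fx κ Φ t p D) (yLFs κ Φ t p D c mk (gT mk gx κ Φ t p D) (fT mk fx κ Φ t p D) (sgOf du) σh) x du z + 1 ≤ 600 * Neg.Kq κ ∧ N3Y κ Φ t p D (gT mk gx κ Φ t p D) (fT mk fx κ Φ t p D) (yLFs κ Φ t p D c mk (gT mk gx κ Φ t p D) (fT mk fx κ Φ t p D) (sgOf du) σh) x z + 1 ≤ 200 * Neg.Kq κ + 10 := by
  have hσ : sgOf du = 1 ∨ sgOf du = -1 := sgOf_sign du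
  obtain ⟨he0, he1, -⟩ := he_yLFs κ Φ t p D c mk gx (fT mk fx κ Φ t p D) hN hκ hS hσ hσh
  have hu1 : 1 ≤ u₁A κ Φ t p D (gT mk gx κ Φ t p D) (fT mk fx κ Φ t p D) := (units_eqA κ Φ t p D (gT mk gx κ Φ t p D) (fT mk fx κ Φ t p D)).2.2.2.2.2.2.2
  have hu0 : 1 ≤ u₀A κ Φ t p D (gT mk gx κ Φ t p D) (fT mk fx κ Φ t p D) := (units_eqA κ Φ t p D (gT mk gx κ Φ t p D) (fT mk fx κ Φ t p D)).2.2.2.2.2.2.1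
  exact ⟨(NrY_range κ Φ t p D (gT mk gx κ Φ t p D) (fT mk fx κ Φ t p D) x du hd z hj hlev1 hlev2 (yLFs κ Φ t p D c mk (gT mk gx κ Φ t p D) (fT mk fx κ Φ t p D) (sgOf du) σh) he1 (by linarith)).2, N3Y_range κ Φ t p D (gT mk gx κ Φ t p D) (fT mk fx κ Φ t p D) (yLFs κ Φ t p D c mk (gT mk gx κ Φ t p D) (fT mk fx κ Φ t p D) (sgOf du) σh) x z hz hkE he0 (by linarith)⟩

end KS

end NegB

end PlanarSkeletonNeg

end Summit.CriticalPhenomena.PercolationContinuityZ3.Theorems.Transplant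

end
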